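import Summits.BirchSwinnertonDyer.Rank1Residual.F1Sign2.LegendreDoorCriterion
import Summits.BirchSwinnertonDyer.Rank1Residual.F1Sign2.EggLemmaAtTwoProofs
import HarnessLib

/-!
# Route `GenusKolyvaginAtTwo`, crux #2 `GenusPrimitiveSupplyAtTwo` (stmt-BirchSwinnertonDyer-22136):
# THE CERTIFYING HALF of the cell's AN-24L `F1Sign2.SingleDoor.LegendreDoorCriterion` — a DOUBLE has `x − e` a SQUARE, so a Legendre symbol
# `((x(P₀) − e)/q) = −1` CERTIFIES the door open at `q` (over any field of characteristic `≠ 2`)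

Width seat `bsd-line-gk2-p4` g13 (cell `bsd-f1-sign2`); lane: the transposition door (`…TranspositionKummerReading`, T-q₀, AN-24S by name).
THEOREMS ONLY (no definition, no named fact, no `sorry`); helper `--supports stmt-BirchSwinnertonDyer-22136`; no item is closed; BSD is not proved
by any of this.

WHAT. AN-24L (`F1Sign2/LegendreDoorCriterion.lean`, -an g8, typed by -ty; «THEOREM on paper, unproved in the tree, D-an-30: proof open to any prover»):
over `ZMod q`, `q` odd, `e` the unique root of the `2`-division cubic, `P = (x, y)` with `2y + a₁x + a₃ ≠ 0`: `(∃ R, 2R = P) ↔ IsSquare (x − e)`.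
This file proves the direction `→` — the one that CERTIFIES an OPEN door (`MeetsNonNormAt`: `P̃₀ ∉ 2Ẽ(𝔽_q)`) from a Legendre-symbol
computation — over ANY field `F` with `2 ≠ 0` and ANY root `e` of `ψ₂` (uniqueness is not needed):
* `isSquare_sub_root_of_add_self_eq` — `R + R = (x, y)` ⟹ `x − e = ((2u² − 4eu − (b₄ + b₂e + 4e²)) / (2(2v + a₁u + a₃)))²` for `R = (u, v)`:
  the duplication formula `X(2R)·ψ₂(u) = u⁴ − b₄u² − 2b₆u − b₈` (`EggDoubling.addX_self_mul_psiTwo`), the square identity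
  `4(dupNum(u) − e·ψ₂(u)) = (2u² − 4eu − (b₄ + b₂e + 4e²))²` (`EggDoubling.four_mul_dupNum_sub_root_mul_psiTwo`) and `ψ₂(u) = (2v + a₁u + a₃)²`;
* `legendreDoorCriterion_mp` — the `→` half of `LegendreDoorCriterion` in its own binders; `not_exists_two_smul_eq_of_not_isSquare`,
  `not_exists_two_smul_eq_of_legendreSym_eq_neg_one` — the certifying contrapositives (`((x − e)/q) = −1 ⟹ P ∉ 2W(𝔽_q)`).
The `←` half (injectivity of the `2`-isogeny descent map over `𝔽_q`; Silverman X.4.9) is NOT proved here: the tree's complete `2`-descent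
(`Literature/…/TwoDescent.lean`) is `CharZero`-only, so it needs an odd-characteristic port (size L, recorded in the lane's API card).

References: [SilvermanAEC2009] III.2.3 (d) (duplication formula), Ex. X.4.8 / Prop. X.4.9 (descent via two-isogeny); [Kramer1981] Prop. 3.
-/

set_option linter.dupNamespace false -- tree convention: `Summit.BirchSwinnertonDyer.BirchSwinnertonDyer.Theorems` (summit = sub-problem)
set_option autoImplicit false

noncomputable section

open scoped Classical

namespace Summit.BirchSwinnertonDyer.BirchSwinnertonDyer.Theorems.GenusKolyTransp

open WeierstrassCurve
open Summit.BirchSwinnertonDyer.Rank1Residual.F1Sign2.EggDoubling (psiTwo dupNum sub_negY_sq_eq_psiTwo addX_self_mul_psiTwo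
  four_mul_dupNum_sub_root_mul_psiTwo)
open Summit.BirchSwinnertonDyer.Rank1Residual.F1Sign2.SingleDoor (LegendreDoorCriterion legendreSym_val_eq_neg_one_iff)

/-! ## §15 A double has `x − e` a square (any field with `2 ≠ 0`, any root `e` of `ψ₂`) -/

/-- **`x(2R) − e` is a square** for every root `e` of the `2`-division cubic `ψ₂` and every affine `R = (u, v)` with `2R ≠ O`, over any field
with `2 ≠ 0`: `(x(2R) − e)·ψ₂(u) = dupNum(u) − e·ψ₂(u) = (2u² − 4eu − (b₄ + b₂e + 4e²))²/4` and `ψ₂(u) = (2v + a₁u + a₃)² ≠ 0`.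
[cite: SilvermanAEC2009, III.2.3 (d) and Prop. X.4.9] -/
theorem isSquare_sub_root_of_add_self_eq {F : Type*} [Field F] [DecidableEq F] (h2 : (2 : F) ≠ 0) (W : WeierstrassCurve F) {e : F}
    (he : psiTwo W e = 0) (R : W.toAffine.Point) {x y : F} {hxy : W.toAffine.Nonsingular x y}
    (hR : R + R = .some x y hxy) : IsSquare (x - e) := by
  rcases R with _ | ⟨u, v, huv⟩
  · rw [← Affine.Point.zero_def, add_zero] at hR
    exact absurd hR.symm (Affine.Point.some_ne_zero _)
  · by_cases hy : v = W.toAffine.negY u v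
    · rw [Affine.Point.add_self_of_Y_eq hy] at hR
      exact absurd hR.symm (Affine.Point.some_ne_zero _)
    · rw [Affine.Point.add_self_of_Y_ne hy] at hR
      have hx : W.toAffine.addX u u (W.toAffine.slope u u v v) = x := (Affine.Point.some.inj hR).1
      set D : F := v - W.toAffine.negY u v with hDdef
      have hD : D ≠ 0 := sub_ne_zero.mpr hy
      have hψ : D ^ 2 = psiTwo W u := sub_negY_sq_eq_psiTwo W huv.1
      have hdup := addX_self_mul_psiTwo W huv.1 hy
      rw [hx] at hdup
      have hsq := four_mul_dupNum_sub_root_mul_psiTwo W he u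
      set s : F := 2 * u ^ 2 - 4 * e * u - (W.b₄ + W.b₂ * e + 4 * e ^ 2) with hsdef
      -- `(x − e)·D² = s²/4`, so `x − e = (s/(2D))²`
      refine ⟨s / (2 * D), ?_⟩
      have h2D : 2 * D ≠ 0 := mul_ne_zero h2 hD
      field_simp
      have key : 4 * ((x - e) * D ^ 2) = s ^ 2 := by
        rw [← hsq, hψ]
        ring_nf
        linear_combination (4 : F) * hdup
      linear_combination key

/-! ## §16 The `→` half of AN-24L and the certifying contrapositives over `ZMod q` -/

/-- **AN-24L, the `→` half** (in the binders of `F1Sign2.SingleDoor.LegendreDoorCriterion`): over `ZMod q`, `q` odd, if the `2`-division cubic has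
exactly one root `e` (only «`e` is a root» is used) and `P = (x, y)` with `2y + a₁x + a₃ ≠ 0` is a double in `W(𝔽_q)`, then `x − e` is a square.
[cite: SilvermanAEC2009, III.2.3 (d) and Prop. X.4.9] -/
theorem legendreDoorCriterion_mp (q : ℕ) [Fact q.Prime] (hq : q ≠ 2) (W : WeierstrassCurve (ZMod q)) [W.IsElliptic] (e : ZMod q)
    (he : ∀ z : ZMod q, 4 * z ^ 3 + W.b₂ * z ^ 2 + 2 * W.b₄ * z + W.b₆ = 0 ↔ z = e)
    (x y : ZMod q) (h : W.toAffine.Nonsingular x y) (_hP : 2 * y + W.a₁ * x + W.a₃ ≠ 0) :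
    (∃ R : W.toAffine.Point, 2 • R = Affine.Point.some x y h) → IsSquare (x - e) := by
  rintro ⟨R, hR⟩
  have h2 : (2 : ZMod q) ≠ 0 := by
    have : ((2 : ℕ) : ZMod q) ≠ 0 := by
      rw [Ne, ZMod.natCast_eq_zero_iff]
      intro hdvd
      exact hq ((Nat.prime_dvd_prime_iff_eq (Fact.out) Nat.prime_two).mp hdvd)
    exact_mod_cast this
  have he' : psiTwo W e = 0 := (he e).mpr rfl
  rw [two_nsmul] at hR
  exact isSquare_sub_root_of_add_self_eq h2 W he' R hR

/-- **A non-square `x − e` CERTIFIES `P ∉ 2W(𝔽_q)`** (the door open at `q`, in the currency of AN-24L): contrapositive of the `→` half.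
[cite: SilvermanAEC2009, Prop. X.4.9] [cite: Kramer1981, Prop. 3] -/
theorem not_exists_two_smul_eq_of_not_isSquare (q : ℕ) [Fact q.Prime] (hq : q ≠ 2) (W : WeierstrassCurve (ZMod q)) [W.IsElliptic]
    (e : ZMod q) (he : ∀ z : ZMod q, 4 * z ^ 3 + W.b₂ * z ^ 2 + 2 * W.b₄ * z + W.b₆ = 0 ↔ z = e)
    (x y : ZMod q) (h : W.toAffine.Nonsingular x y) (hP : 2 * y + W.a₁ * x + W.a₃ ≠ 0) (hns : ¬ IsSquare (x - e)) :
    ¬ ∃ R : W.toAffine.Point, 2 • R = Affine.Point.some x y h :=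
  fun hR ↦ hns (legendreDoorCriterion_mp q hq W e he x y h hP hR)

/-- **A Legendre symbol `((x − e)/q) = −1` CERTIFIES `P ∉ 2W(𝔽_q)`** (AN-24L primed, `→` half). [cite: SilvermanAEC2009, Prop. X.4.9] -/
theorem not_exists_two_smul_eq_of_legendreSym_eq_neg_one (q : ℕ) [Fact q.Prime] (hq : q ≠ 2) (W : WeierstrassCurve (ZMod q))
    [W.IsElliptic] (e : ZMod q) (he : ∀ z : ZMod q, 4 * z ^ 3 + W.b₂ * z ^ 2 + 2 * W.b₄ * z + W.b₆ = 0 ↔ z = e)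
    (x y : ZMod q) (h : W.toAffine.Nonsingular x y) (hP : 2 * y + W.a₁ * x + W.a₃ ≠ 0) (hleg : legendreSym q (x - e).val = -1) :
    ¬ ∃ R : W.toAffine.Point, 2 • R = Affine.Point.some x y h :=
  not_exists_two_smul_eq_of_not_isSquare q hq W e he x y h hP ((legendreSym_val_eq_neg_one_iff q _).mp hleg)

/-- **`LegendreDoorCriterion` reduces to its `←` half**: granted «`x − e` square ⟹ `P ∈ 2W(𝔽_q)`» (the injectivity of the `2`-isogeny descent
map over `𝔽_q`, NOT proved here), AN-24L holds. [cite: SilvermanAEC2009, Ex. X.4.8 and Prop. X.4.9] -/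
theorem legendreDoorCriterion_of_converse
    (hconv : ∀ (q : ℕ) [Fact q.Prime], q ≠ 2 → ∀ (W : WeierstrassCurve (ZMod q)) [W.IsElliptic] (e : ZMod q),
      (∀ z : ZMod q, 4 * z ^ 3 + W.b₂ * z ^ 2 + 2 * W.b₄ * z + W.b₆ = 0 ↔ z = e) →
      ∀ (x y : ZMod q) (h : W.toAffine.Nonsingular x y), 2 * y + W.a₁ * x + W.a₃ ≠ 0 →
        IsSquare (x - e) → ∃ R : W.toAffine.Point, 2 • R = Affine.Point.some x y h) :
    LegendreDoorCriterion :=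
  fun q _ hq W _ e he x y h hP ↦ ⟨legendreDoorCriterion_mp q hq W e he x y h hP, hconv q hq W e he x y h hP⟩

end Summit.BirchSwinnertonDyer.BirchSwinnertonDyer.Theorems.GenusKolyTransp

end
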